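import Summits.Ventures.PercRepro.S2SpanningCount
import Summits.Ventures.PercRepro.RankLevelSetCoreSevenOfFormSplitKY

/-!
# PercRepro — THE GIANT-FLAT CASE SPLIT OF A LEVEL-`7` CELL: THE CONCENTRATED SPANNING TAIL OF A BIG RANK-`≤ 7` SET,
AND THE TELESCOPING BOUNDS WITH THE GIANT TERM OF A GIVEN FLAT BOUND (p9, gen 29; S4 — the cells `(37, 71 … 73)`)

The cells `(p, d)` of level `7` at `d ≈ 70` fail in the KY technology on the powerset term `2^{min 79 (7 + d)}` of the
giant rank-`7` flat against the crude spanning count `Σ_{j ≤ d} C(n, j)`: no circuit count moves them. THE CASE SPLIT: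
either some rank-`≤ 7` set `W` has `≥ d − 2` points — then `W` has nullity `≥ d − 9`, and by p7 g12's concentrated tail
(`S2.ncard_spanning_le_of_nullity`: the complement of a spanning set has `≤ d` points, at most `d − k` of them outside a
set of nullity `k`) the spanning sets number at most `Σ_{m ≤ d} Σ_{j ∈ [m − 9, m]} C(79, j)·C(p + 2, m − j)`
(**`ncard_spanning_le_bigflat`**; `|W| ≤ 79` by the `e`-free flat bound, `|E ∖ W| ≤ p + 2`) — or every rank-`≤ 7` set
has `≤ d − 3` points, and the giant term is `2^{d − 3}`. **`giant_bounds_of_flat_bound`** packages, for ANY flat bound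
`g`, the two telescoping bounds the parametrised core (RankLevelSetCoreSevenOfFormTelGiant) takes as
hypotheses — the count of the rank-`7` sets of size `≤ d` at `k = 0` (`S2.ncard_eRk_eq_ncard_le_le_tel7` at
`f = min g (7 + d)`) and the count of all rank-`7` sets through it (`S2.ncard_eRk_eq_le_ncard_le_add_two_pow`) — with
the giant term `2^{min g (7 + d)}`; the cap of the telescoping recursion is rewritten to the `79`-form of `nsideTelK7` by
the numeric hypothesis `hcap` (both caps are `ν₁ − 2` at the cells). Axioms: standard.
-/

set_option exponentiation.threshold 1024

open scoped Matroid

namespace PercRepro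

namespace ThmN

open Set

variable {α : Type}

/-- **The concentrated spanning tail of a big rank-`≤ 7` set**: if `W ⊆ E` has rank `≤ 7`, `d − 2 ≤ |W| ≤ 79`, in a
finite matroid of rank `p` with `|E| = p + d`, then the spanning sets number at most
`Σ_{m ≤ d} Σ_{j ∈ [m − 9, m]} C(79, j)·C(p + 2, m − j)` (p7 g12's `S2.ncard_spanning_le_of_nullity` at `W`, whose
nullity is `≥ d − 9`, with `|W| ≤ 79` and `|E ∖ W| ≤ p + 2`). -/
theorem ncard_spanning_le_bigflat (M : Matroid α) [M.Finite] {p d : ℕ} (hR : M.eRank = (p : ℕ∞))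
    (hn : M.E.ncard = p + d) {W : Set α} (hW : W ⊆ M.E) (hr : M.eRk W ≤ 7) (hbig : d - 2 ≤ W.ncard)
    (h79 : W.ncard ≤ 79) :
    {X : Set α | X ⊆ M.E ∧ M.eRk X = M.eRank}.ncard ≤
      ∑ m ∈ Finset.range (d + 1), ∑ j ∈ Finset.Icc (m - 9) m, (79 : ℕ).choose j * (p + 2).choose (m - j) := by
  have hd : M.E.encard = M.eRank + d := by
    rw [hR, ← M.ground_finite.cast_ncard_eq, hn]
    push_cast
    ring
  have hWfin : W.Finite := M.ground_finite.subset hW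
  have hne : M.eRk W ≠ ⊤ := ((M.eRk_le_encard _).trans_lt hWfin.encard_lt_top).ne
  obtain ⟨r, hr'⟩ := ENat.ne_top_iff_exists.1 hne
  have hrW : r ≤ W.ncard := by
    have := M.eRk_le_encard W
    rw [← hr', ← hWfin.cast_ncard_eq] at this
    exact_mod_cast this
  have hr7 : r ≤ 7 := by
    rw [← hr'] at hr
    exact_mod_cast hr
  -- the nullity `k = |W| − r ≥ d − 9` of `W`
  have hk : W.encard = M.eRk W + (W.ncard - r) := by
    rw [← hr', ← hWfin.cast_ncard_eq]
    have : W.ncard = r + (W.ncard - r) := by omega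
    conv_lhs => rw [this]
    push_cast
    rfl
  refine (S2.ncard_spanning_le_of_nullity M hW hd hk).trans ?_
  rw [hn]
  refine Finset.sum_le_sum fun m _ => ?_
  -- the inner sum: a sub-range of `[m − 9, m]`, termwise `C(|W|, j) ≤ C(79, j)` and `C(p + d − |W|, m − j) ≤ C(p + 2, m − j)`
  refine (Finset.sum_le_sum_of_subset_of_nonneg ?_ fun _ _ _ => Nat.zero_le _).trans (Finset.sum_le_sum fun j _ => ?_)
  · intro j hj
    rw [Finset.mem_Icc] at hj ⊢
    omega
  · exact Nat.mul_le_mul (Nat.choose_le_choose j h79) (Nat.choose_le_choose (m - j) (by omega))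

/-- **The telescoping bounds with the giant term of a flat bound `g`** (`k = 0`): on the `e`-free core of rank `p`,
`|E| = p + d`, `47 ≤ d`, if every rank-`≤ 7` set has `≤ g` points and the telescoping caps agree (`hcap`),
then (i) the rank-`7` sets of size `≤ d` number at most the independent `7`-sets plus the telescoping sum (the cap in
its `79`-form) plus `2^{min g (7 + d)}`, and (ii) every rank-`7` set is of size `≤ d` or among `2^{min g (7 + d)}` sets —
the hypotheses `hU0` / `hall` of `c025_core_seven_of_form_tel_giant` with `G = 2^{min g (7 + d)}`. -/
theorem giant_bounds_of_flat_bound (M : Matroid α) [M.Finite] (p d g : ℕ) (hd47 : 47 ≤ d)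
    (hR : M.eRank = (p : ℕ∞)) (hn : M.E.ncard = p + d)
    (hfree : ∀ e ∈ M.E, ∃ A ⊆ M.E \ {e}, e ∉ M.closure A ∧ e ∉ M.closure ((M.E \ {e}) \ A))
    (hg : ∀ X ⊆ M.E, M.eRk X ≤ 7 → X.ncard ≤ g)
    (hcap : min (min g (7 + d) - (7 + 1)) (max ((d + min 33 d) / 2 + 1) (min 32 (d - 1) + 2) - 2) =
      min (min 79 (7 + d - 0) - 8) (max ((d + min 33 d) / 2 + 1) (min 32 (d - 1) + 2) - 2)) :
    (({B : Set α | B ⊆ M.E ∧ M.eRk B = (7 : ℕ) ∧ B.ncard ≤ d}.ncard : ℚ) ≤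
      ({B : Set α | B ⊆ M.E ∧ M.eRk B = (7 : ℕ) ∧ B.ncard = 7}.ncard : ℚ) +
        (∑ j ∈ Finset.range (d - 7), S2.lamTel (((p + d).choose 7 : ℕ) : ℚ)
          ((({C | M.IsCircuit C ∧ C.ncard = 3}.ncard : ℕ) : ℚ) * (((p + d - 3).choose 5 : ℕ) : ℚ) +
            (({C | M.IsCircuit C ∧ C.ncard = 4}.ncard : ℕ) : ℚ) * (((p + d - 4).choose 4 : ℕ) : ℚ) +
            (({C | M.IsCircuit C ∧ C.ncard = 5}.ncard : ℕ) : ℚ) * (((p + d - 5).choose 3 : ℕ) : ℚ) +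
            (({C | M.IsCircuit C ∧ C.ncard = 6}.ncard : ℕ) : ℚ) * (((p + d - 6).choose 2 : ℕ) : ℚ) +
            (({C | M.IsCircuit C ∧ C.ncard = 7}.ncard : ℕ) : ℚ) * (((p + d - 7 : ℕ)) : ℚ) +
            (({C | M.IsCircuit C ∧ C.ncard = 8}.ncard : ℕ) : ℚ) * ((1 : ℕ) : ℚ))
          (min (min 79 (7 + d - 0) - 8) (max ((d + min 33 d) / 2 + 1) (min 32 (d - 1) + 2) - 2))
          (fun ν => ν + S2.rminF ν) (j + 1)) + ((2 ^ (min g (7 + d) : ℕ) : ℕ) : ℚ)) ∧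
    ({X : Set α | X ⊆ M.E ∧ M.eRk X = 7}.ncard ≤
      {X : Set α | X ⊆ M.E ∧ M.eRk X = 7 ∧ X.ncard ≤ d}.ncard + 2 ^ (min g (7 + d) : ℕ)) := by
  classical
  -- the core is simple: every circuit has `≥ 3` elements
  have hL0 : ∀ e ∈ M.E, ¬ M.IsLoop e := not_isLoop_of_free M hfree
  have hs : ∀ e ∈ M.E, ∀ f ∈ M.E, e ≠ f → M.eRk {e, f} = 2 := by
    intro e he f hf hef
    have h2 : (2 : ℕ∞) ≤ M.eRk {e, f} :=
      two_le_eRk_of_two_le_ncard_of_free M hfree (pair_subset he hf) (by rw [ncard_pair hef])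
    have h3 : M.eRk {e, f} ≤ 2 := by
      have := M.eRk_le_encard {e, f}
      rwa [encard_pair hef] at this
    exact le_antisymm h3 h2
  have hcirc : ∀ C, M.IsCircuit C → 3 ≤ C.encard := three_le_encard_of_circuit M hL0 hs
  have hd : M.E.encard = M.eRank + d := by
    rw [hR, ← M.ground_finite.cast_ncard_eq, hn]
    push_cast
    ring
  -- the nullity cap: every `X ⊆ E` has `|X| ≤ r(X) + d`
  have hcap' : ∀ X ⊆ M.E, ∀ k : ℕ, M.eRk X ≤ k → X.ncard ≤ k + d := by
    intro X hX k hr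
    have h1 := Matroid.encard_le_eRk_add_of_encard_eq hX hd
    have h2 : X.encard ≤ (k : ℕ∞) + d := h1.trans (by gcongr)
    have hfin : X.Finite := M.ground_finite.subset hX
    rw [← hfin.cast_ncard_eq] at h2
    exact_mod_cast h2
  have hflatg : ∀ X ⊆ M.E, M.eRk X ≤ 7 → X.ncard ≤ min g (7 + d) :=
    fun X hX hr => le_min (hg X hX hr) (hcap' X hX 7 hr)
  have hflat' : ∀ X ⊆ M.E, M.eRk X ≤ ((7 - 1 : ℕ) : ℕ∞) → X.ncard ≤ min 39 (6 + d) :=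
    fun X hX hr => le_min (ncard_le_thirtynine_of_eRk_le_six_of_free M hfree hX (by simpa using hr))
      (hcap' X hX 6 (by simpa using hr))
  have hinter := hinter_seven M hd hfree
  have hC1 : ∀ L ⊆ M.E, M.eRk L = 2 → L.ncard ≤ 3 :=
    fun L hL hr => ncard_le_three_of_eRk_two M hs hfree hL hr
  have hC2 : ∀ P ⊆ M.E, M.eRk P ≤ 3 → P.ncard ≤ 6 :=
    fun P hP hr => ncard_le_six_of_eRk_le_three_of_free M hfree hP hr
  have hf0 : ∀ X ⊆ M.E, M.eRk X ≤ 0 → X.ncard ≤ 0 := fun X hX hr => by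
    have := ncard_add_one_le_two_pow_of_eRk_le M hL0 hfree 0 X hX (by exact_mod_cast hr)
    omega
  have hf1 : ∀ X ⊆ M.E, M.eRk X ≤ 1 → X.ncard ≤ 1 := fun X hX hr => by
    have := ncard_add_one_le_two_pow_of_eRk_le M hL0 hfree 1 X hX (by exact_mod_cast hr)
    omega
  have hf2 : ∀ X ⊆ M.E, M.eRk X ≤ 2 → X.ncard ≤ 3 := fun X hX hr => by
    have := ncard_add_one_le_two_pow_of_eRk_le M hL0 hfree 2 X hX (by exact_mod_cast hr)
    omega
  have hf4 : ∀ X ⊆ M.E, M.eRk X ≤ 4 → X.ncard ≤ 10 :=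
    fun X hX hr => ncard_le_ten_of_eRk_le_four_of_free M hfree hX hr
  have hf5 : ∀ X ⊆ M.E, M.eRk X ≤ 5 → X.ncard ≤ 19 :=
    fun X hX hr => ncard_le_nineteen_of_eRk_le_five_of_free M hfree hX hr
  have hf6 : ∀ X ⊆ M.E, M.eRk X ≤ 6 → X.ncard ≤ 39 :=
    fun X hX hr => ncard_le_thirtynine_of_eRk_le_six_of_free M hfree hX hr
  -- the non-coloop bound on every level set
  have hcol : ∀ m, 7 + 1 ≤ m → m ≤ d → ∀ B ∈ Matroid.levelF M 7 m,
      (fun ν => ν + S2.rminF ν) (m - 7) ≤ (S2.nonColoops M 7 B).card := by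
    intro m hm _ B hB
    rw [Matroid.levelF, Finset.mem_filter, Finset.mem_powersetCard] at hB
    obtain ⟨⟨hBsub, hBcard⟩, hBr⟩ := hB
    have hBE : (B : Set α) ⊆ M.E := by
      rw [← Matroid.coe_groundF M]; exact_mod_cast hBsub
    have := S2.card_nonColoops_ge_of_flat_bounds (M := M) B hBE (by exact_mod_cast hBr) (by omega)
      hf0 hf1 hf2 hC2 hf4 hf5 hf6
    rw [hBcard] at this
    exact this
  have hρ : ∀ ν, 1 ≤ (fun ν => ν + S2.rminF ν) (ν + 1) := fun ν => by
    have := S2.one_le_rminF (ν + 1)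
    simp only
    omega
  have hm3 : min (min g (7 + d)) (7 + d) = min g (7 + d) := by omega
  constructor
  · -- (i) the count of the rank-`7` sets of size `≤ d` at `k = 0`
    have hU0 := S2.ncard_eRk_eq_ncard_le_le_tel7 M 7 (min g (7 + d)) (min 39 (6 + d))
      (max ((d + min 33 d) / 2 + 1) (min 32 (d - 1) + 2)) (min 33 d) (fun ν => ν + S2.rminF ν)
      (by norm_num) hcirc hC1 hC2 hflatg hflat' hinter hd (by omega) (by omega) hρ hcol
    rw [hn, sum_Icc_three_eight_q, hcap, hm3] at hU0
    simp only [show (7 : ℕ) + 1 = 8 from rfl, show (8 : ℕ) - 3 = 5 from rfl, show (8 : ℕ) - 4 = 4 from rfl,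
      show (8 : ℕ) - 5 = 3 from rfl, show (8 : ℕ) - 6 = 2 from rfl, show (8 : ℕ) - 7 = 1 from rfl,
      show (8 : ℕ) - 8 = 0 from rfl, Nat.choose_one_right, Nat.choose_zero_right] at hU0
    push_cast
    exact hU0
  · -- (ii) every rank-`7` set is of size `≤ d` or lies in the giant flat
    have hall := S2.ncard_eRk_eq_le_ncard_le_add_two_pow (M := M) 7 (min g (7 + d)) (min 39 (6 + d))
      (max ((d + min 33 d) / 2 + 1) (min 32 (d - 1) + 2)) (min 33 d) (by norm_num) hcirc hC1 hC2 hflatg hflat'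
      hinter hd (by omega) (by omega) (by omega)
    rw [hm3] at hall
    exact hall

end ThmN

end PercRepro
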